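import Literature.Geometry.Manifold.DirectLimitManifold
import Literature.Geometry.Manifold.BilinSectionTransport
import Literature.Geometry.Manifold.ConnectionSecondCountable
import Literature.Geometry.Lorentzian.LorentzianMetric
import HarnessLib

/-!
# The metric of a direct limit of (pseudo-)Riemannian or Lorentzian manifolds along isometric
# open embeddings

Continuation of `Literature.Geometry.Manifold.DirectLimitManifold`: if the pieces `obj i` of a
smooth directed system `d` along injective local diffeomorphisms carry `C^n` pseudo-Riemannian
metrics `g i` (of class `C^∞`) for which the transition maps are isometric immersions
(`(g i).IsIsometricImmersion (g j) (map i j h)`), then the limit manifold `d.Limit` carries a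
unique `C^∞` pseudo-Riemannian metric `d.limitMetric g hg` making every canonical map
`incl i : obj i → lim obj` an isometric immersion; it is Lorentzian when the pieces are
(`d.limitLorentzianMetric`), and the limit is then second countable by Geroch's theorem
(`Literature.Geometry.Manifold.secondCountableTopology_of_covariantDerivative`) — with no time
orientation needed. This is the metric `g̃` on the union `K̃ = ⋃ N_α` of a totally ordered family of
developments (Choquet-Bruhat–Geroch, Comm. Math. Phys. 14 (1969), proof of Thm. 3, p. 333: *"K̃
… carries a Lorentz metric such that each `ψ_α : N_α → K̃` is an isometry onto its image"*), the
metric layer of item (a) of `Literature.Geometry.Lorentzian.CauchyProblemMGHDExistenceProofs`,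
§ "What remains".

Construction. On the open image of the piece `i` the metric is the pullback of `g i` along the
smooth inverse `(incl i)⁻¹` (`d.inclSymm i`); by the isometry hypothesis and the chain rule these
local definitions agree on overlaps (`pullbackBilin_inclSymm_eq_of_le`,
`pullbackBilin_inclSymm_eq`), so the value at `z` may be computed in any piece containing `z`
(`limitVal_eq`); smoothness is then local (`contMDiffAt_pullbackBilin_of_contMDiffAt`,
`Literature.Geometry.Manifold.BilinSectionTransport`), and nondegeneracy / the Lorentzian
signature are read off through the invertible differential of `(incl i)⁻¹`.

* `d.inclSymm i`, `d.inclSymm_incl`, `d.incl_inclSymm`, `d.contMDiffAt_inclSymm`,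
  `d.mfderiv_inclSymm_comp_mfderiv_incl`, `d.mfderiv_incl_comp_mfderiv_inclSymm`,
  `d.injective_mfderiv_inclSymm`;
* `d.limitMetric g hg : PseudoRiemannianMetric 𝓘(ℝ, E) ∞ E (TangentSpace 𝓘(ℝ, E) : d.Limit → _)`,
  `d.limitMetric_val_eq` (its value on the image of a piece), `d.isIsometricImmersion_incl`;
* `d.limitLorentzianMetric`, `d.secondCountableTopology_limit_of_lorentzian`.

## References

* Y. Choquet-Bruhat, R. Geroch, Comm. Math. Phys. 14 (1969) 329–335, proof of Thm. 3, p. 333.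
  [ChoquetBruhatGeroch1969CMP]
* B. O'Neill, *Semi-Riemannian geometry* (1983), Ch. 3, Def. 3.9, pp. 58, 90–91 (pullback
  metrics along local diffeomorphisms). [ONeill1983]
* R. Geroch, J. Math. Phys. 9 (1968) 1739–1744, Appendix. [Geroch1968JMP]
-/

open scoped Manifold ContDiff Topology
open Bundle Set Function Filter _root_.Topology OpenPartialHomeomorph

noncomputable section

namespace Literature.Geometry.Manifold

namespace SmoothDirectLimitData

open Literature.Geometry.Lorentzian Literature.Geometry.Lorentzian.PseudoRiemannianMetric

universe u v w

variable {E : Type v} [NormedAddCommGroup E] [NormedSpace ℝ E] {ι : Type w} [Preorder ι]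
  [IsDirectedOrder ι] (d : SmoothDirectLimitData.{u, v, w} E ι)

/-! ### The smooth inverses of the canonical maps -/

/-- The inverse `(incl i)⁻¹ : lim obj → obj i` of the canonical map (junk off `range (incl i)`).
[folklore] -/
def inclSymm (i : ι) : d.Limit → d.obj i :=
  ((d.isOpenEmbedding_incl i).toOpenPartialHomeomorph (d.incl i)).symm

/-- `(incl i)⁻¹ (incl i x) = x`. [folklore] -/
@[simp] theorem inclSymm_incl (i : ι) (x : d.obj i) : d.inclSymm i (d.incl i x) = x :=
  (d.isOpenEmbedding_incl i).toOpenPartialHomeomorph_left_inv _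

/-- `incl i ((incl i)⁻¹ z) = z` on the image of the piece. [folklore] -/
theorem incl_inclSymm (i : ι) {z : d.Limit} (hz : z ∈ range (d.incl i)) :
    d.incl i (d.inclSymm i z) = z :=
  (d.isOpenEmbedding_incl i).toOpenPartialHomeomorph_right_inv _ hz

/-- `(incl i)⁻¹` is smooth at every point of the (open) image of the piece. [folklore] -/
theorem contMDiffAt_inclSymm (i : ι) {z : d.Limit} (hz : z ∈ range (d.incl i)) :
    ContMDiffAt 𝓘(ℝ, E) 𝓘(ℝ, E) ∞ (d.inclSymm i) z :=
  (d.contMDiffOn_inclSymm i).contMDiffAt ((d.isOpen_range_incl i).mem_nhds hz)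

/-- On the image of an earlier piece, the inverse of a later canonical map factors through the
transition map: `(incl k)⁻¹ = map i k ∘ (incl i)⁻¹` on `range (incl i)`. [folklore] -/
theorem inclSymm_eq_map_inclSymm {i k : ι} (hik : i ≤ k) {z : d.Limit}
    (hz : z ∈ range (d.incl i)) : d.inclSymm k z = d.map i k hik (d.inclSymm i z) := by
  obtain ⟨x, rfl⟩ := hz
  rw [inclSymm_incl, ← d.incl_map hik, inclSymm_incl]

/-- Chain rule for the canonical map and its inverse: `d((incl i)⁻¹) ∘ d(incl i) = id`.
[folklore] -/
theorem mfderiv_inclSymm_comp_mfderiv_incl (i : ι) (x : d.obj i) :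
    (mfderiv 𝓘(ℝ, E) 𝓘(ℝ, E) (d.inclSymm i) (d.incl i x)).comp
        (mfderiv 𝓘(ℝ, E) 𝓘(ℝ, E) (d.incl i) x) = ContinuousLinearMap.id ℝ _ := by
  have h1 : MDifferentiableAt 𝓘(ℝ, E) 𝓘(ℝ, E) (d.inclSymm i) (d.incl i x) :=
    (d.contMDiffAt_inclSymm i ⟨x, rfl⟩).mdifferentiableAt (by simp)
  have h2 : MDifferentiableAt 𝓘(ℝ, E) 𝓘(ℝ, E) (d.incl i) x :=
    ((d.contMDiff_incl i) x).mdifferentiableAt (by simp)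
  have h := mfderiv_comp x h1 h2
  have hid : d.inclSymm i ∘ d.incl i = id := funext fun y ↦ d.inclSymm_incl i y
  rw [hid, mfderiv_id] at h
  exact h.symm

/-- Chain rule on the image of the piece: `d(incl i) ∘ d((incl i)⁻¹) = id` at `incl i x`.
[folklore] -/
theorem mfderiv_incl_comp_mfderiv_inclSymm (i : ι) (x : d.obj i) :
    (mfderiv 𝓘(ℝ, E) 𝓘(ℝ, E) (d.incl i) x).comp
        (mfderiv 𝓘(ℝ, E) 𝓘(ℝ, E) (d.inclSymm i) (d.incl i x)) = ContinuousLinearMap.id ℝ _ := by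
  have h1 : MDifferentiableAt 𝓘(ℝ, E) 𝓘(ℝ, E) (d.inclSymm i) (d.incl i x) :=
    (d.contMDiffAt_inclSymm i ⟨x, rfl⟩).mdifferentiableAt (by simp)
  have h2 : MDifferentiableAt 𝓘(ℝ, E) 𝓘(ℝ, E) (d.incl i) (d.inclSymm i (d.incl i x)) := by
    rw [inclSymm_incl]
    exact ((d.contMDiff_incl i) x).mdifferentiableAt (by simp)
  have h := mfderiv_comp (d.incl i x) h2 h1
  have hev : d.incl i ∘ d.inclSymm i =ᶠ[𝓝 (d.incl i x)] id :=
    Filter.eventuallyEq_of_mem ((d.isOpen_range_incl i).mem_nhds ⟨x, rfl⟩)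
      fun z hz ↦ d.incl_inclSymm i hz
  rw [hev.mfderiv_eq, mfderiv_id] at h
  rw [inclSymm_incl] at h
  exact h.symm

/-- The differential of `(incl i)⁻¹` at a point of the image is injective (indeed invertible).
[folklore] -/
theorem injective_mfderiv_inclSymm (i : ι) {z : d.Limit} (hz : z ∈ range (d.incl i)) :
    Injective (mfderiv 𝓘(ℝ, E) 𝓘(ℝ, E) (d.inclSymm i) z) := by
  obtain ⟨x, rfl⟩ := hz
  intro v w hvw
  have h := d.mfderiv_incl_comp_mfderiv_inclSymm i x
  have hv : mfderiv 𝓘(ℝ, E) 𝓘(ℝ, E) (d.incl i) x (mfderiv 𝓘(ℝ, E) 𝓘(ℝ, E) (d.inclSymm i) _ v) = v :=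
    DFunLike.congr_fun h v
  have hw : mfderiv 𝓘(ℝ, E) 𝓘(ℝ, E) (d.incl i) x (mfderiv 𝓘(ℝ, E) 𝓘(ℝ, E) (d.inclSymm i) _ w) = w :=
    DFunLike.congr_fun h w
  calc v = mfderiv 𝓘(ℝ, E) 𝓘(ℝ, E) (d.incl i) x (mfderiv 𝓘(ℝ, E) 𝓘(ℝ, E) (d.inclSymm i) _ v) :=
        hv.symm
    _ = mfderiv 𝓘(ℝ, E) 𝓘(ℝ, E) (d.incl i) x (mfderiv 𝓘(ℝ, E) 𝓘(ℝ, E) (d.inclSymm i) _ w) := by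
        rw [hvw]
    _ = w := hw

/-! ### The metric -/

variable (g : ∀ i, PseudoRiemannianMetric 𝓘(ℝ, E) ∞ E (TangentSpace 𝓘(ℝ, E) : d.obj i → Type _))
  (hg : ∀ i j (h : i ≤ j), (g i).IsIsometricImmersion (g j) (d.map i j h))

include hg in
/-- **Compatibility of the local pullbacks**: on the image of an earlier piece `i ≤ k`, pulling
back `g k` along `(incl k)⁻¹` gives the same form as pulling back `g i` along `(incl i)⁻¹`
(chain rule and the isometry `map i k`). [cite: ChoquetBruhatGeroch1969CMP, proof of Thm. 3 (p. 333)] -/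
theorem pullbackBilin_inclSymm_eq_of_le {i k : ι} (hik : i ≤ k) {z : d.Limit}
    (hz : z ∈ range (d.incl i)) :
    pullbackBilin (I := 𝓘(ℝ, E)) (I' := 𝓘(ℝ, E)) (d.inclSymm k) (g k).val z =
      pullbackBilin (I := 𝓘(ℝ, E)) (I' := 𝓘(ℝ, E)) (d.inclSymm i) (g i).val z := by
  have hev : d.inclSymm k =ᶠ[𝓝 z] (d.map i k hik ∘ d.inclSymm i) :=
    Filter.eventuallyEq_of_mem ((d.isOpen_range_incl i).mem_nhds hz)
      fun z' hz' ↦ d.inclSymm_eq_map_inclSymm hik hz'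
  have h1 : MDifferentiableAt 𝓘(ℝ, E) 𝓘(ℝ, E) (d.inclSymm i) z :=
    (d.contMDiffAt_inclSymm i hz).mdifferentiableAt (by simp)
  have h2 : MDifferentiableAt 𝓘(ℝ, E) 𝓘(ℝ, E) (d.map i k hik) (d.inclSymm i z) :=
    ((d.isLocalDiffeomorph i k hik).contMDiff _).mdifferentiableAt (by simp)
  have hd : mfderiv 𝓘(ℝ, E) 𝓘(ℝ, E) (d.inclSymm k) z =
      (mfderiv 𝓘(ℝ, E) 𝓘(ℝ, E) (d.map i k hik) (d.inclSymm i z)).comp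
        (mfderiv 𝓘(ℝ, E) 𝓘(ℝ, E) (d.inclSymm i) z) := by
    rw [hev.mfderiv_eq, mfderiv_comp z h2 h1]
  have hiso := (hg i k hik).2 (d.inclSymm i z)
  ext v w
  rw [pullbackBilin_apply, pullbackBilin_apply, hd, d.inclSymm_eq_map_inclSymm hik hz]
  have := DFunLike.congr_fun (DFunLike.congr_fun hiso
    (mfderiv 𝓘(ℝ, E) 𝓘(ℝ, E) (d.inclSymm i) z v)) (mfderiv 𝓘(ℝ, E) 𝓘(ℝ, E) (d.inclSymm i) z w)
  rw [pullbackBilin_apply] at this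
  exact this

include hg in
/-- Hence the local pullbacks of any two pieces containing `z` agree. [folklore] -/
theorem pullbackBilin_inclSymm_eq {i j : ι} {z : d.Limit} (hi : z ∈ range (d.incl i))
    (hj : z ∈ range (d.incl j)) :
    pullbackBilin (I := 𝓘(ℝ, E)) (I' := 𝓘(ℝ, E)) (d.inclSymm i) (g i).val z =
      pullbackBilin (I := 𝓘(ℝ, E)) (I' := 𝓘(ℝ, E)) (d.inclSymm j) (g j).val z := by
  obtain ⟨k, hik, hjk⟩ := exists_ge_ge i j
  rw [← d.pullbackBilin_inclSymm_eq_of_le g hg hik hi, d.pullbackBilin_inclSymm_eq_of_le g hg hjk hj]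

/-- The value of the limit metric at `z`: the pullback of `g i` along `(incl i)⁻¹` for a chosen
piece `i` containing `z`. [folklore] -/
def limitVal (z : d.Limit) :
    TangentSpace 𝓘(ℝ, E) z →L[ℝ] TangentSpace 𝓘(ℝ, E) z →L[ℝ] ℝ :=
  pullbackBilin (I := 𝓘(ℝ, E)) (I' := 𝓘(ℝ, E)) (d.inclSymm (Classical.choose (d.exists_eq_incl z)))
    (g (Classical.choose (d.exists_eq_incl z))).val z

include hg in
/-- **The limit metric may be computed in any piece containing the point.** [folklore] -/
theorem limitVal_eq {i : ι} {z : d.Limit} (hz : z ∈ range (d.incl i)) :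
    d.limitVal g z = pullbackBilin (I := 𝓘(ℝ, E)) (I' := 𝓘(ℝ, E)) (d.inclSymm i) (g i).val z := by
  have hc : z ∈ range (d.incl (Classical.choose (d.exists_eq_incl z))) :=
    ⟨_, (Classical.choose_spec (Classical.choose_spec (d.exists_eq_incl z))).symm⟩
  exact d.pullbackBilin_inclSymm_eq g hg hc hz

variable [FiniteDimensional ℝ E]

include hg in
/-- **The metric of the direct limit**: the unique field of bilinear forms on `T(lim obj)` which on
the image of each piece is the pullback of `g i` along `(incl i)⁻¹`; it is symmetric,
nondegenerate (the differential of `(incl i)⁻¹` being invertible) and `C^∞` (locally a pullback of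
a `C^∞` field along a `C^∞` map). [cite: ChoquetBruhatGeroch1969CMP, proof of Thm. 3 (p. 333)] -/
def limitMetric : PseudoRiemannianMetric 𝓘(ℝ, E) ∞ E (TangentSpace 𝓘(ℝ, E) : d.Limit → Type _) where
  val := d.limitVal g
  symm z v w := by
    obtain ⟨i, x, rfl⟩ := d.exists_eq_incl z
    rw [d.limitVal_eq g hg ⟨x, rfl⟩]
    exact pullbackBilin_symm _ _ (g i).symm _ v w
  nondegenerate z v hv := by
    obtain ⟨i, x, rfl⟩ := d.exists_eq_incl z
    have hinj := d.injective_mfderiv_inclSymm i (z := d.incl i x) ⟨x, rfl⟩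
    apply hinj
    rw [map_zero]
    refine (g i).nondegenerate _ _ fun w ↦ ?_
    obtain ⟨w', rfl⟩ := (mfderiv_bijective_of_injective hinj rfl).2 w
    have := hv w'
    rw [d.limitVal_eq g hg ⟨x, rfl⟩, pullbackBilin_apply] at this
    exact this
  contMDiff := by
    intro z₀
    obtain ⟨i, x, rfl⟩ := d.exists_eq_incl z₀
    have hU : IsOpen (range (d.incl i)) := d.isOpen_range_incl i
    have hloc := contMDiffOn_pullbackBilin_of_contMDiffAt (I := 𝓘(ℝ, E)) (I' := 𝓘(ℝ, E)) hU
      (f := d.inclSymm i) (s := (g i).val) (n := ∞)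
      (fun z hz ↦ (d.contMDiffAt_inclSymm i hz).contMDiffWithinAt)
      (fun z _ ↦ (g i).contMDiff _)
    refine ((hloc.contMDiffAt (hU.mem_nhds ⟨x, rfl⟩)).congr_of_eventuallyEq ?_)
    filter_upwards [hU.mem_nhds ⟨x, rfl⟩] with z hz
    rw [d.limitVal_eq g hg hz]

/-- The value of the limit metric on the image of a piece. [folklore] -/
theorem limitMetric_val_eq {i : ι} {z : d.Limit} (hz : z ∈ range (d.incl i)) :
    (d.limitMetric g hg).val z =
      pullbackBilin (I := 𝓘(ℝ, E)) (I' := 𝓘(ℝ, E)) (d.inclSymm i) (g i).val z :=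
  d.limitVal_eq g hg hz

/-- **Each canonical map is an isometric immersion into the limit**:
`(incl i)^* g̃ = g i` ("each `ψ_α : N_α → K̃` is an isometry onto its image").
[cite: ChoquetBruhatGeroch1969CMP, proof of Thm. 3 (p. 333)] -/
theorem isIsometricImmersion_incl (i : ι) :
    (g i).IsIsometricImmersion (d.limitMetric g hg) (d.incl i) := by
  refine ⟨d.contMDiff_incl i, fun x ↦ ?_⟩
  ext v w
  rw [pullbackBilin_apply, d.limitMetric_val_eq g hg ⟨x, rfl⟩, pullbackBilin_apply]
  have h := d.mfderiv_inclSymm_comp_mfderiv_incl i x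
  have hv : mfderiv 𝓘(ℝ, E) 𝓘(ℝ, E) (d.inclSymm i) _ (mfderiv 𝓘(ℝ, E) 𝓘(ℝ, E) (d.incl i) x v) = v :=
    DFunLike.congr_fun h v
  have hw : mfderiv 𝓘(ℝ, E) 𝓘(ℝ, E) (d.inclSymm i) _ (mfderiv 𝓘(ℝ, E) 𝓘(ℝ, E) (d.incl i) x w) = w :=
    DFunLike.congr_fun h w
  rw [hv, hw, inclSymm_incl]

/-! ### Lorentzian pieces -/

/-- **The direct limit of Lorentzian manifolds along isometric open embeddings is Lorentzian**: the
signature is read off in a piece through the invertible differential of `(incl i)⁻¹`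
(cf. `LorentzianMetric.comap`). [cite: ChoquetBruhatGeroch1969CMP, proof of Thm. 3 (p. 333)] -/
def limitLorentzianMetric (gL : ∀ i, LorentzianMetric 𝓘(ℝ, E) ∞ (d.obj i))
    (hgL : ∀ i j (h : i ≤ j), (gL i).IsIsometricImmersion (gL j).toPseudoRiemannianMetric (d.map i j h)) :
    LorentzianMetric 𝓘(ℝ, E) ∞ d.Limit where
  toPseudoRiemannianMetric := d.limitMetric (fun i ↦ (gL i).toPseudoRiemannianMetric) hgL
  exists_timelike z := by
    obtain ⟨i, x, rfl⟩ := d.exists_eq_incl z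
    have hinj := d.injective_mfderiv_inclSymm i (z := d.incl i x) ⟨x, rfl⟩
    obtain ⟨v, hv⟩ := (gL i).exists_timelike (d.inclSymm i (d.incl i x))
    refine ⟨(mfderivEquivOfInjective (I := 𝓘(ℝ, E)) (I' := 𝓘(ℝ, E)) (d.inclSymm i) _ hinj rfl).symm v, ?_⟩
    rw [d.limitMetric_val_eq _ hgL ⟨x, rfl⟩, pullbackBilin_apply]
    simpa using hv
  pos_of_orthogonal z v w hv hvw hw := by
    obtain ⟨i, x, rfl⟩ := d.exists_eq_incl z
    have hinj := d.injective_mfderiv_inclSymm i (z := d.incl i x) ⟨x, rfl⟩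
    change (d.limitMetric _ hgL).val _ _ _ < 0 at hv
    change (d.limitMetric _ hgL).val _ _ _ = 0 at hvw
    change 0 < (d.limitMetric _ hgL).val _ _ _
    rw [d.limitMetric_val_eq _ hgL ⟨x, rfl⟩, pullbackBilin_apply] at hv hvw ⊢
    exact (gL i).pos_of_orthogonal _ _ _ hv hvw fun h ↦ hw (hinj (by rw [h, map_zero]))

/-- **The direct limit of connected Lorentzian manifolds along isometric open embeddings is second
countable** (Geroch 1968: it is a connected Hausdorff manifold with a `C^∞` Lorentzian metric; `PseudoRiemannianMetric.secondCountableTopology_of_two_le`) — the countability of the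
union `K̃` of a chain of developments, obtained BEFORE any time orientation on it.
[cite: Geroch1968JMP, Appendix] [cite: ChoquetBruhatGeroch1969CMP, proof of Thm. 3 (p. 333)] -/
theorem secondCountableTopology_limit_of_lorentzian [Nonempty ι] [∀ i, T2Space (d.obj i)]
    [∀ i, ConnectedSpace (d.obj i)] (gL : ∀ i, LorentzianMetric 𝓘(ℝ, E) ∞ (d.obj i))
    (hgL : ∀ i j (h : i ≤ j), (gL i).IsIsometricImmersion (gL j).toPseudoRiemannianMetric (d.map i j h)) :
    SecondCountableTopology d.Limit :=
  (d.limitLorentzianMetric gL hgL).toPseudoRiemannianMetric.secondCountableTopology_of_two_le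
    (by simpa using (WithTop.coe_le_coe.2 le_top : ((2 : ℕ∞) : ℕ∞ω) ≤ ∞))

end SmoothDirectLimitData

end Literature.Geometry.Manifold

end
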